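import Literature.NumberTheory.Transcendental.FormIntegrationAddProofs
import Literature.Geometry.Kaehler.ManifoldFormsChart
import Literature.NumberTheory.Transcendental.FormsAlgebra
import Mathlib.Geometry.Manifold.Diffeomorph
import Mathlib.Geometry.Manifold.LocalDiffeomorph
import Mathlib.MeasureTheory.Function.Jacobian
import Mathlib.MeasureTheory.Measure.Lebesgue.EqHaar
import HarnessLib

/-!
# Chart-level change of variables along a smooth map (towards `∫_M f^*β = ∫_N β`)

Topic: integration of top-degree forms on compact oriented manifolds (Warner (1983), §4.8;
Lee (2013), Ch. 16). This file is the chart-level toolkit for the discharge of the named fact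
`Literature.Geometry.Kaehler.MForm.integral_pullback` (diffeomorphism invariance of `∫_M`,
Warner (1983), 4.8 eq. (5); Lee (2013), Prop. 16.6(d)) and of the independence of the integral
of the partition of unity (`Literature.Geometry.Kaehler.MForm.integralPU_eq_integral`,
Warner (1983), 4.8 eqs. (2)–(4)), carried out in
`Literature/NumberTheory/Transcendental/FormIntegrationPullbackProofs.lean`. Everything here is
proved, for every model with corners (all derivatives are taken within `range I`).

Fix a `C^∞` map `f : M → N` of `C^∞` manifolds (models `I` on `E`, `I'` on `E'`), a chart
centre `x₀ : M`, a chart centre `x₁ : N`, and the *transition map through `f`*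
`σ = extChartAt I' x₁ ∘ f ∘ (extChartAt I x₀).symm : E → E'`, meaningful on
`U = (extChartAt I x₀).target ∩ (extChartAt I x₀).symm ⁻¹' (f ⁻¹' (extChartAt I' x₁).source)`.

## Main statements (all proved)

* `fderivWithin_extChartAt_comp_comp_symm`: on `U`, `Dσ = D(extChartAt I' x₁) ∘ Df ∘ D(chart⁻¹)`
  (chain rule for `mfderiv`), and `mfderivWithin_extChartAt_symm_comp_fderivWithin_transition`:
  `D(chart'⁻¹) ∘ Dσ = Df ∘ D(chart⁻¹)`.
* `MForm.inChart_pullback_apply`: the chart representative of `f^*β` in the chart at `x₀` is the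
  pull-back along `Dσ` of the representative of `β` in the chart at `x₁` (Warner (1983), 2.22);
  this is the two-centre version of `Literature.Geometry.Kaehler.MForm.inChart_pullback_eq` of
  `Literature/Geometry/Kaehler/ManifoldFormsPullback.lean` (which treats the preferred charts at
  `x` and `f x`, i.e. `x₀ = x`, `x₁ = f x`), needed here for arbitrary pairs of charts.
* `chartSign_eq_sign_det_mul_chartSign_transition`: under orientation compatibility
  `o' (f x) = (Df_x)_* (o x)`, chart signs transform by the sign of the Jacobian determinant of
  `σ` (Lee (2013), Prop. 15.6 / 16.6(d)).
* `isContinuousOrientation_of_orientationMap`: the orientation family `o` of `M` is continuous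
  when `o'` is and `f` is an orientation-compatible local diffeomorphism.
* `integral_image_eq_integral_abs_basisDet_smul`: the change of variables formula between two
  finite-dimensional spaces carrying the Lebesgue measures of bases `e`, `e'` (Mathlib's
  `integral_image_eq_integral_abs_det_fderiv_smul` transported along the linear isomorphism
  `e' ↦ e`), with Jacobian factor `|e'.det (Dσ e₁, …, Dσ eₙ)|`.
* `setIntegral_chartIntegrand_pullback_eq`: **the chart integral of `(g ∘ f) · f^*β` in the
  chart at `x₀` equals the chart integral of `g · β` in the chart at `x₁`** when `g` is
  supported in `f '' (chart source at x₀) ∩ (chart source at x₁)` — Warner (1983), 4.8 eq. (4)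
  with a map inserted; for `f = id` this is the chart independence
  `setIntegral_chartIntegrand_eq_of_support_subset` of `FormIntegrationPUProofs.lean`.

## References

* F. W. Warner, *Foundations of Differentiable Manifolds and Lie Groups*, GTM 94, Springer
  (1983), 2.22 (pull-back of forms), 4.8 (integration on an oriented manifold, eqs. (2)–(5),
  PDF pp. 145–147).
* J. M. Lee, *Introduction to Smooth Manifolds*, 2nd ed., GTM 218, Springer (2013),
  Prop. 15.6, Prop. 16.5–16.6.
-/

noncomputable section

open scoped Manifold ContDiff Topology
open Bundle Set Module MeasureTheory Function Filter

namespace Literature.NumberTheory.Transcendental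

/-! ### Top-degree alternating forms evaluated on transported frames -/

section TopAlgebra

variable {V W : Type*} [AddCommGroup V] [Module ℝ V] [AddCommGroup W] [Module ℝ W]
  {ι : Type*} [Fintype ι] [DecidableEq ι]

/-- A top-degree alternating form `ψ` on `W`, evaluated on the image of a basis `e` of `V`
under a linear map `T : V → W`, is `e'.det (T e₁, …, T eₙ) · ψ (e'₁, …, e'ₙ)` for any basis `e'`
of `W` (top forms are multiples of `e'.det`, `AlternatingMap.eq_smul_basis_det`).
Lee (2013), Prop. 14.9. [cite: LeeSmoothManifolds2013, Prop. 14.9] -/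
theorem AlternatingMap.apply_comp_basis_eq_basisDet_mul (e : Basis ι ℝ V) (e' : Basis ι ℝ W)
    (ψ : W [⋀^ι]→ₗ[ℝ] ℝ) (T : V →ₗ[ℝ] W) :
    ψ (fun i ↦ T (e i)) = e'.det (fun i ↦ T (e i)) * ψ e' := by
  have h := AlternatingMap.eq_smul_basis_det e' ψ
  conv_lhs => rw [h]
  rw [AlternatingMap.smul_apply, smul_eq_mul, mul_comm]

/-- Variant of `AlternatingMap.apply_comp_basis_eq_basisDet_mul` with the top form `ψ` living on a
third space `X` and the frame transported further by a linear map `A : W → X`: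
`ψ (A (T e₁), …, A (T eₙ)) = e'.det (T e₁, …, T eₙ) · ψ (A e'₁, …, A e'ₙ)`.
[cite: LeeSmoothManifolds2013, Prop. 14.9] -/
theorem AlternatingMap.apply_comp_comp_basis_eq_basisDet_mul {X : Type*} [AddCommGroup X]
    [Module ℝ X] (e : Basis ι ℝ V) (e' : Basis ι ℝ W) (ψ : X [⋀^ι]→ₗ[ℝ] ℝ) (A : W →ₗ[ℝ] X)
    (T : V →ₗ[ℝ] W) :
    ψ (fun i ↦ A (T (e i))) = e'.det (fun i ↦ T (e i)) * ψ (fun i ↦ A (e' i)) :=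
  AlternatingMap.apply_comp_basis_eq_basisDet_mul e e' (ψ.compLinearMap A) T

omit [Fintype ι] [DecidableEq ι] in
/-- The sign of `someVector` of the ray of a nonzero top form `ψ` on a frame is the sign of `ψ`
on that frame (the two forms are positive multiples of each other). [folklore] -/
theorem sign_someVector_rayOfNeZero (ψ : V [⋀^ι]→ₗ[ℝ] ℝ) (hψ : ψ ≠ 0) (w : ι → V) :
    Real.sign ((rayOfNeZero ℝ ψ hψ).someVector w) = Real.sign (ψ w) := by
  have h0 := Module.Ray.someVector_ne_zero (rayOfNeZero ℝ ψ hψ)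
  have hray : SameRay ℝ (rayOfNeZero ℝ ψ hψ).someVector ψ := by
    rw [← ray_eq_iff (R := ℝ) h0 hψ, Module.Ray.someVector_ray]
  obtain ⟨c, hc, hcv⟩ := hray.exists_pos_right h0 hψ
  rw [hcv, AlternatingMap.smul_apply, smul_eq_mul, real_sign_mul, Real.sign_of_pos hc, one_mul]

omit [Fintype ι] [DecidableEq ι] in
/-- **Signs of frames under transport of orientations.** For a linear isomorphism `L : V ≃ W`
and an orientation `r` of `V`, the orientation `L_* r = Orientation.map ι L r` of `W` gives the
frame `(L u₁, …, L uₙ)` the same sign as `r` gives `(u₁, …, uₙ)`. Lee (2013), Ch. 15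
(orientation-preserving isomorphisms). [cite: LeeSmoothManifolds2013, Prop. 15.6] -/
theorem sign_someVector_orientationMap (L : V ≃ₗ[ℝ] W) (r : Orientation ℝ V ι) (u : ι → V) :
    Real.sign ((Orientation.map ι L r).someVector fun i ↦ L (u i)) =
      Real.sign (r.someVector u) := by
  have hr : r = rayOfNeZero ℝ r.someVector (Module.Ray.someVector_ne_zero r) :=
    (Module.Ray.someVector_ray r).symm
  conv_lhs => rw [hr, Orientation.map_apply]
  rw [sign_someVector_rayOfNeZero]
  simp only [AlternatingMap.compLinearMap_apply, LinearEquiv.coe_coe,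
    LinearEquiv.symm_apply_apply]

/-- With `Λ = e'.equiv e (Equiv.refl ι) : W ≃ V` the isomorphism sending `e'` to `e`, the
determinant of the endomorphism `Λ ∘ T` of `V` is the mixed-basis determinant
`e'.det (T e₁, …, T eₙ)` (`= det` of the matrix of `T` in the bases `e`, `e'`). [folklore] -/
theorem det_basisEquiv_comp (e : Basis ι ℝ V) (e' : Basis ι ℝ W) (T : V →ₗ[ℝ] W) :
    LinearMap.det ((e'.equiv e (Equiv.refl ι) : W →ₗ[ℝ] V) ∘ₗ T) =
      e'.det (fun i ↦ T (e i)) := by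
  set Λ := e'.equiv e (Equiv.refl ι) with hΛ
  have hmap : e'.map Λ = e := by
    rw [hΛ, Basis.map_equiv]
    exact e.reindex_refl
  have h2 := Basis.det_comp e ((Λ : W →ₗ[ℝ] V) ∘ₗ T) e
  rw [Basis.det_self, mul_one] at h2
  rw [← h2]
  have h3 := Basis.det_map e' Λ ((((Λ : W →ₗ[ℝ] V) ∘ₗ T) : V → V) ∘ (e : ι → V))
  rw [hmap] at h3
  rw [h3]
  congr 1
  funext i
  simp only [Function.comp_apply, LinearMap.coe_comp, LinearEquiv.coe_coe,
    LinearEquiv.symm_apply_apply]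

end TopAlgebra

/-! ### Change of variables between two finite-dimensional spaces with basis measures -/

section CoV

variable {V W F : Type*} [NormedAddCommGroup V] [NormedSpace ℝ V] [FiniteDimensional ℝ V]
  [MeasurableSpace V] [BorelSpace V] [NormedAddCommGroup W] [NormedSpace ℝ W]
  [FiniteDimensional ℝ W] [MeasurableSpace W] [BorelSpace W] [NormedAddCommGroup F]
  [NormedSpace ℝ F] {ι : Type*} [Fintype ι] [DecidableEq ι]

omit [FiniteDimensional ℝ V] [MeasurableSpace V] [BorelSpace V] [MeasurableSpace W]
  [BorelSpace W] in
/-- Continuous version of `det_basisEquiv_comp`: the determinant of `Λ ∘ T`, with `Λ` the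
continuous linear isomorphism sending the basis `e'` of `W` to the basis `e` of `V`, is
`e'.det (T e₁, …, T eₙ)`. [folklore] -/
theorem det_basisEquivL_comp (e : Basis ι ℝ V) (e' : Basis ι ℝ W) (T : V →L[ℝ] W) :
    (((e'.equiv e (Equiv.refl ι)).toContinuousLinearEquiv : W →L[ℝ] V).comp T).det =
      e'.det (fun i ↦ T (e i)) := by
  rw [ContinuousLinearMap.det]
  exact det_basisEquiv_comp e e' (T : V →ₗ[ℝ] W)

omit [DecidableEq ι] in
/-- The continuous linear isomorphism sending the basis `e'` of `W` to the basis `e` of `V`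
transports the Lebesgue measure of `e'` to that of `e`. [folklore] -/
theorem measurePreserving_basisEquivL (e : Basis ι ℝ V) (e' : Basis ι ℝ W) :
    MeasurePreserving ((e'.equiv e (Equiv.refl ι)).toContinuousLinearEquiv : W → V)
      e'.addHaar e.addHaar := by
  set Λ := (e'.equiv e (Equiv.refl ι)).toContinuousLinearEquiv with hΛ
  have hmap : e'.map Λ.toLinearEquiv = e := by
    have : Λ.toLinearEquiv = e'.equiv e (Equiv.refl ι) := rfl
    rw [this, Basis.map_equiv]
    exact e.reindex_refl
  refine ⟨Λ.continuous.measurable, ?_⟩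
  rw [Basis.map_addHaar, hmap]

omit [FiniteDimensional ℝ V] [MeasurableSpace V] [BorelSpace V] [FiniteDimensional ℝ W]
  [MeasurableSpace W] [BorelSpace W] in
/-- Continuous version of `AlternatingMap.apply_comp_basis_eq_basisDet_mul`: a continuous top form
`ψ` on `W` evaluated on `(T e₁, …, T eₙ)` is `e'.det (T e₁, …, T eₙ) · ψ (e')`.
[cite: LeeSmoothManifolds2013, Prop. 14.9] -/
theorem ContinuousAlternatingMap.apply_comp_basis_eq_basisDet_mul (e : Basis ι ℝ V)
    (e' : Basis ι ℝ W) (ψ : W [⋀^ι]→L[ℝ] ℝ) (T : V →L[ℝ] W) :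
    ψ (fun i ↦ T (e i)) = e'.det (fun i ↦ T (e i)) * ψ e' :=
  AlternatingMap.apply_comp_basis_eq_basisDet_mul e e' ψ.toAlternatingMap (T : V →ₗ[ℝ] W)

omit [FiniteDimensional ℝ V] [MeasurableSpace V] [BorelSpace V] [MeasurableSpace W]
  [BorelSpace W] in
/-- The mixed-basis Jacobian determinant `T ↦ e'.det (T e₁, …, T eₙ)` is a continuous function
of the continuous linear map `T` (it is the determinant of `Λ ∘ T`). [folklore] -/
theorem continuous_basisDet_apply_comp (e : Basis ι ℝ V) (e' : Basis ι ℝ W) :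
    Continuous fun T : V →L[ℝ] W ↦ e'.det (fun i ↦ T (e i)) := by
  set Λ : W →L[ℝ] V := ((e'.equiv e (Equiv.refl ι)).toContinuousLinearEquiv : W →L[ℝ] V)
    with hΛ
  refine (ContinuousLinearMap.continuous_det.comp
    (ContinuousLinearMap.compL ℝ V W V Λ).continuous).congr fun T ↦ ?_
  simp only [Function.comp_apply, ContinuousLinearMap.compL_apply, hΛ]
  exact det_basisEquivL_comp e e' T

omit [MeasurableSpace V] [BorelSpace V] [FiniteDimensional ℝ W] [MeasurableSpace W]
  [BorelSpace W] in
/-- The mixed-basis Jacobian determinant of an injective `T` (between spaces of the same finite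
dimension) is nonzero. [folklore] -/
theorem basisDet_apply_comp_ne_zero (e : Basis ι ℝ V) (e' : Basis ι ℝ W) {T : V →L[ℝ] W}
    (hT : Function.Injective T) : e'.det (fun i ↦ T (e i)) ≠ 0 := by
  have h : LinearMap.det ((e'.equiv e (Equiv.refl ι) : W →ₗ[ℝ] V) ∘ₗ (T : V →ₗ[ℝ] W)) =
      e'.det (fun i ↦ T (e i)) := det_basisEquiv_comp e e' (T : V →ₗ[ℝ] W)
  rw [← h]
  intro h0
  rw [LinearMap.det_eq_zero_iff_ker_ne_bot] at h0
  refine h0 (LinearMap.ker_eq_bot.2 ?_)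
  simp only [LinearMap.coe_comp, LinearEquiv.coe_coe, ContinuousLinearMap.coe_coe]
  exact (LinearEquiv.injective _).comp hT

/-- The sign of a real function continuous within `s` at a point where it does not vanish is
locally constant there (within `s`). [folklore] -/
theorem eventually_sign_eq_of_continuousWithinAt {X : Type*} [TopologicalSpace X] {d : X → ℝ}
    {s : Set X} {y₀ : X} (hd : ContinuousWithinAt d s y₀) (h0 : d y₀ ≠ 0) :
    ∀ᶠ y in 𝓝[s] y₀, Real.sign (d y) = Real.sign (d y₀) := by
  rcases lt_trichotomy (d y₀) 0 with h | h | h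
  · filter_upwards [hd.tendsto.eventually (gt_mem_nhds h)] with y hy
    rw [Real.sign_of_neg hy, Real.sign_of_neg h]
  · exact absurd h h0
  · filter_upwards [hd.tendsto.eventually (lt_mem_nhds h)] with y hy
    rw [Real.sign_of_pos hy, Real.sign_of_pos h]

/-- **Change of variables between two finite-dimensional real vector spaces of the same
dimension**, each carrying the Lebesgue measure of a chosen basis (`e` on `V`, `e'` on `W`): for
`σ : V → W` injective on a measurable set `s` and differentiable there (within `s`) with
derivative `σ'`, and any `G : W → F`,
`∫_{σ '' s} G ∂λ_{e'} = ∫_s |e'.det (σ' e₁, …, σ' eₙ)| • G ∘ σ ∂λ_e`. This is Mathlib's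
`integral_image_eq_integral_abs_det_fderiv_smul` (for maps `V → V`) transported along the
measure-preserving isomorphism `e' ↦ e`; the Jacobian factor is the absolute determinant of the
matrix of `σ'` in the bases `e`, `e'`. Warner (1983), 4.5(2) / Lee (2013), Thm. C.26.
[cite: Warner1983, 4.5(2)] -/
theorem integral_image_eq_integral_abs_basisDet_smul (e : Basis ι ℝ V) (e' : Basis ι ℝ W)
    {s : Set V} (hs : MeasurableSet s) {σ : V → W} {σ' : V → V →L[ℝ] W}
    (hσ' : ∀ y ∈ s, HasFDerivWithinAt σ (σ' y) s y) (hσ : InjOn σ s) (G : W → F) :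
    ∫ y' in σ '' s, G y' ∂e'.addHaar =
      ∫ y in s, |e'.det (fun i ↦ σ' y (e i))| • G (σ y) ∂e.addHaar := by
  set Λ := (e'.equiv e (Equiv.refl ι)).toContinuousLinearEquiv with hΛ
  have hmp : MeasurePreserving (Λ : W → V) e'.addHaar e.addHaar := measurePreserving_basisEquivL e e'
  have h1 : ∫ y' in σ '' s, G y' ∂e'.addHaar =
      ∫ z in ((Λ : W → V) ∘ σ) '' s, G (Λ.symm z) ∂e.addHaar := by
    have h := hmp.setIntegral_image_emb Λ.toHomeomorph.measurableEmbedding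
      (fun z ↦ G (Λ.symm z)) (σ '' s)
    simp only [ContinuousLinearEquiv.symm_apply_apply] at h
    rw [Set.image_comp]
    exact h.symm
  have hderiv : ∀ y ∈ s, HasFDerivWithinAt ((Λ : W → V) ∘ σ) ((Λ : W →L[ℝ] V).comp (σ' y)) s y :=
    fun y hy ↦ (Λ : W →L[ℝ] V).hasFDerivAt.comp_hasFDerivWithinAt y (hσ' y hy)
  have hinj : InjOn ((Λ : W → V) ∘ σ) s := Λ.injective.comp_injOn hσ
  rw [h1, integral_image_eq_integral_abs_det_fderiv_smul e.addHaar hs hderiv hinj]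
  refine setIntegral_congr_fun hs fun y _ ↦ ?_
  simp only [Function.comp_apply, ContinuousLinearEquiv.symm_apply_apply]
  rw [det_basisEquivL_comp e e' (σ' y)]

end CoV

/-! ### The transition map through `f` between a chart of `M` and a chart of `N` -/

section Transition

variable {E : Type*} [NormedAddCommGroup E] [NormedSpace ℝ E]
  {H : Type*} [TopologicalSpace H] {I : ModelWithCorners ℝ E H}
  {M : Type*} [TopologicalSpace M] [ChartedSpace H M] [IsManifold I ∞ M]
  {E' : Type*} [NormedAddCommGroup E'] [NormedSpace ℝ E']
  {H' : Type*} [TopologicalSpace H'] {I' : ModelWithCorners ℝ E' H'}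
  {N : Type*} [TopologicalSpace N] [ChartedSpace H' N] [IsManifold I' ∞ N]
  {F : Type*} [NormedAddCommGroup F] [NormedSpace ℝ F] {k : ℕ}

/-- **Chain rule for the transition map through `f`.** At a point `y` of the target of the chart
at `x₀` whose image `x = (extChartAt I x₀).symm y` is mapped by `f` into the source of the
chart at `x₁`, the derivative within `range I` of
`σ = extChartAt I' x₁ ∘ f ∘ (extChartAt I x₀).symm` is
`D(extChartAt I' x₁)(f x) ∘ Df(x) ∘ D((extChartAt I x₀).symm)(y)`. [folklore] -/
theorem fderivWithin_extChartAt_comp_comp_symm {f : M → N} {x₀ : M} {x₁ : N} {y : E}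
    (hy : y ∈ (extChartAt I x₀).target)
    (hf : MDifferentiableAt I I' f ((extChartAt I x₀).symm y))
    (h₁ : f ((extChartAt I x₀).symm y) ∈ (extChartAt I' x₁).source) :
    fderivWithin ℝ (extChartAt I' x₁ ∘ f ∘ (extChartAt I x₀).symm) (range I) y =
      (mfderiv I' 𝓘(ℝ, E') (extChartAt I' x₁) (f ((extChartAt I x₀).symm y))).comp
        ((mfderiv I I' f ((extChartAt I x₀).symm y)).comp
          (mfderivWithin 𝓘(ℝ, E) I (extChartAt I x₀).symm (range I) y)) := by
  have hU : UniqueMDiffWithinAt 𝓘(ℝ, E) (range I) y :=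
    I.uniqueMDiffOn _ (extChartAt_target_subset_range x₀ hy)
  have h0 : MDifferentiableWithinAt 𝓘(ℝ, E) I (extChartAt I x₀).symm (range I) y :=
    mdifferentiableWithinAt_extChartAt_symm hy
  have h2 : MDifferentiableAt I' 𝓘(ℝ, E') (extChartAt I' x₁) (f ((extChartAt I x₀).symm y)) :=
    mdifferentiableAt_extChartAt (by rwa [← extChartAt_source I'])
  have h3 : MDifferentiableWithinAt 𝓘(ℝ, E) I' (f ∘ (extChartAt I x₀).symm) (range I) y :=
    hf.comp_mdifferentiableWithinAt _ h0
  rw [← mfderivWithin_eq_fderivWithin,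
    mfderiv_comp_mfderivWithin (g := extChartAt I' x₁) (f := f ∘ (extChartAt I x₀).symm) _ h2 h3 hU,
    mfderiv_comp_mfderivWithin _ hf h0 hU]
  rfl

/-- At such a point, composing the derivative of the transition map through `f` with the
derivative of the inverse chart of `N` at `x₁` recovers `Df(x) ∘ D((extChartAt I x₀).symm)(y)`
(the derivative of the chart at `x₁` cancels, `mfderivWithin_extChartAt_symm_comp_mfderiv_extChartAt'`).
[folklore] -/
theorem mfderivWithin_extChartAt_symm_comp_fderivWithin_transition {f : M → N} {x₀ : M}
    {x₁ : N} {y : E} (hy : y ∈ (extChartAt I x₀).target)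
    (hf : MDifferentiableAt I I' f ((extChartAt I x₀).symm y))
    (h₁ : f ((extChartAt I x₀).symm y) ∈ (extChartAt I' x₁).source) :
    (mfderivWithin 𝓘(ℝ, E') I' (extChartAt I' x₁).symm (range I')
        (extChartAt I' x₁ (f ((extChartAt I x₀).symm y)))).comp
      (fderivWithin ℝ (extChartAt I' x₁ ∘ f ∘ (extChartAt I x₀).symm) (range I) y :) =
    (mfderiv I I' f ((extChartAt I x₀).symm y)).comp
      (mfderivWithin 𝓘(ℝ, E) I (extChartAt I x₀).symm (range I) y) := by
  rw [fderivWithin_extChartAt_comp_comp_symm hy hf h₁]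
  ext w
  exact DFunLike.congr_fun (mfderivWithin_extChartAt_symm_comp_mfderiv_extChartAt' h₁) _

omit [IsManifold I' ∞ N] in
/-- Evaluating a form at propositionally equal points on the same (model-space valued) vectors
gives the same value (transport along `TangentSpace I' p = E'`). [folklore] -/
theorem _root_.Literature.Geometry.Kaehler.MForm.apply_congr_point
    (β : Literature.Geometry.Kaehler.MForm I' N F k) {p q : N} (h : p = q) (w : Fin k → E') :
    β p w = β q w := by
  subst h
  rfl

/-- **Chart representative of a pull-back** (Warner (1983), 2.22, local expression of `f^*β`):
at a point `y` of the target of the chart at `x₀` with `f ((extChartAt I x₀).symm y)` in the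
source of the chart at `x₁`, the representative of `f^*β` in the chart at `x₀` is the pull-back,
along the derivative (within `range I`) of the transition map
`σ = extChartAt I' x₁ ∘ f ∘ (extChartAt I x₀).symm`, of the representative of `β` in the chart at
`x₁` at `σ y`. [cite: Warner1983, 2.22] -/
theorem _root_.Literature.Geometry.Kaehler.MForm.inChart_pullback_apply
    (β : Literature.Geometry.Kaehler.MForm I' N F k) {f : M → N} {x₀ : M} {x₁ : N} {y : E}
    (hy : y ∈ (extChartAt I x₀).target)
    (hf : MDifferentiableAt I I' f ((extChartAt I x₀).symm y))
    (h₁ : f ((extChartAt I x₀).symm y) ∈ (extChartAt I' x₁).source) (v : Fin k → E) :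
    (β.pullback I f).inChart x₀ y v =
      β.inChart x₁ (extChartAt I' x₁ (f ((extChartAt I x₀).symm y)))
        (fun i ↦ fderivWithin ℝ (extChartAt I' x₁ ∘ f ∘ (extChartAt I x₀).symm) (range I) y
          (v i)) := by
  have hfx : (extChartAt I' x₁).symm (extChartAt I' x₁ (f ((extChartAt I x₀).symm y))) =
      f ((extChartAt I x₀).symm y) := (extChartAt I' x₁).left_inv h₁
  have key := mfderivWithin_extChartAt_symm_comp_fderivWithin_transition hy hf h₁
  rw [Literature.Geometry.Kaehler.MForm.inChart_apply, Literature.Geometry.Kaehler.MForm.inChart_apply,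
    Literature.Geometry.Kaehler.MForm.pullback_apply, β.apply_congr_point hfx]
  congr 1
  funext i
  exact (DFunLike.congr_fun key (v i)).symm

omit [IsManifold I ∞ M] [IsManifold I' ∞ N] in
/-- The transition map through `f` takes values in `range I'`. [folklore] -/
theorem mapsTo_transition_range (f : M → N) (x₀ : M) (x₁ : N) :
    MapsTo (extChartAt I' x₁ ∘ f ∘ (extChartAt I x₀).symm) (range I) (range I') :=
  fun w _ ↦ by
    simp only [Function.comp_apply, extChartAt_coe]
    exact mem_range_self _

/-- The transition map through a `C^∞` map `f` is `C^∞` within `range I` at the points of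
`U`. [folklore] -/
theorem contDiffWithinAt_transition {f : M → N} (hf : ContMDiff I I' ∞ f) {x₀ : M} {x₁ : N}
    {y : E} (hy : y ∈ (extChartAt I x₀).target)
    (h₁ : f ((extChartAt I x₀).symm y) ∈ (extChartAt I' x₁).source) :
    ContDiffWithinAt ℝ ∞ (extChartAt I' x₁ ∘ f ∘ (extChartAt I x₀).symm) (range I) y := by
  have h0 : ContMDiffWithinAt 𝓘(ℝ, E) I ∞ (extChartAt I x₀).symm (range I) y :=
    contMDiffWithinAt_extChartAt_symm_range x₀ hy
  have h2 : ContMDiffAt I' 𝓘(ℝ, E') ∞ (extChartAt I' x₁) (f ((extChartAt I x₀).symm y)) :=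
    contMDiffAt_extChartAt' (by rwa [← extChartAt_source I'])
  exact ((h2.comp _ (hf _)).comp_contMDiffWithinAt y h0).contDiffWithinAt

omit [IsManifold I ∞ M] [IsManifold I' ∞ N] in
/-- The points `y` near a point `y₀` of the target of the chart at `x₀` (within `range I`) stay
in the target and keep `f ((extChartAt I x₀).symm y)` inside the source of the chart at `x₁`,
provided this holds at `y₀` (`U` is a neighbourhood of its points within `range I`).
[folklore] -/
theorem eventually_mem_transitionDomain {f : M → N} (hf : Continuous f) {x₀ : M} {x₁ : N}
    {y₀ : E} (hy₀ : y₀ ∈ (extChartAt I x₀).target)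
    (h₁ : f ((extChartAt I x₀).symm y₀) ∈ (extChartAt I' x₁).source) :
    ∀ᶠ y in 𝓝[range I] y₀, y ∈ (extChartAt I x₀).target ∧
      f ((extChartAt I x₀).symm y) ∈ (extChartAt I' x₁).source := by
  have ha : ∀ᶠ y in 𝓝[range I] y₀, y ∈ (extChartAt I x₀).target :=
    extChartAt_target_mem_nhdsWithin_of_mem hy₀
  have hb : ∀ᶠ y in 𝓝[range I] y₀, f ((extChartAt I x₀).symm y) ∈ (extChartAt I' x₁).source := by
    refine eventually_nhdsWithin_of_eventually_nhds ?_
    have hc : ContinuousAt (f ∘ (extChartAt I x₀).symm) y₀ :=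
      hf.continuousAt.comp (continuousAt_extChartAt_symm'' hy₀)
    exact hc.preimage_mem_nhds (extChartAt_source_mem_nhds' h₁)
  exact ha.and hb

end Transition

/-! ### Chart signs and chart integrals under an orientation-compatible map -/

section Sign

variable {E : Type*} [NormedAddCommGroup E] [NormedSpace ℝ E] [FiniteDimensional ℝ E]
  {n : ℕ} [Fact (finrank ℝ E = n)]
  {H : Type*} [TopologicalSpace H] {I : ModelWithCorners ℝ E H}
  {M : Type*} [TopologicalSpace M] [ChartedSpace H M] [IsManifold I ∞ M]
  {E' : Type*} [NormedAddCommGroup E'] [NormedSpace ℝ E'] [FiniteDimensional ℝ E']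
  [Fact (finrank ℝ E' = n)]
  {H' : Type*} [TopologicalSpace H'] {I' : ModelWithCorners ℝ E' H'}
  {N : Type*} [TopologicalSpace N] [ChartedSpace H' N] [IsManifold I' ∞ N]
  (o : (x : M) → Orientation ℝ (TangentSpace I x) (Fin n))
  (o' : (x : N) → Orientation ℝ (TangentSpace I' x) (Fin n))

/-- **Chart signs under the transition map through an orientation-compatible map.** Let
`x = (extChartAt I x₀).symm y` for a point `y` of the chart target with `f x` in the source of
the chart at `x₁`, and suppose `Df(x)` underlies a linear isomorphism `L` with
`L_* (o x) = o' (f x)`. Then the sign of the chart of `M` at `x₀` at `y` is the sign of the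
Jacobian determinant `e'.det (Dσ e₁, …, Dσ eₙ)` of the transition map through `f` times the sign
of the chart of `N` at `x₁` at `σ y` (chain rule `D(chart'⁻¹) ∘ Dσ = Df ∘ D(chart⁻¹)` and
`AlternatingMap.eq_smul_basis_det`). Lee (2013), Prop. 15.6 / proof of Prop. 16.6(d).
[cite: LeeSmoothManifolds2013, Prop. 16.6] -/
theorem chartSign_eq_sign_det_mul_chartSign_transition {f : M → N} {x₀ : M} {x₁ : N} {y : E}
    (hy : y ∈ (extChartAt I x₀).target)
    (hf : MDifferentiableAt I I' f ((extChartAt I x₀).symm y))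
    (h₁ : f ((extChartAt I x₀).symm y) ∈ (extChartAt I' x₁).source)
    (L : TangentSpace I ((extChartAt I x₀).symm y) ≃ₗ[ℝ]
      TangentSpace I' (f ((extChartAt I x₀).symm y)))
    (hL : ∀ v, L v = mfderiv I I' f ((extChartAt I x₀).symm y) v)
    (hoL : Orientation.map (Fin n) L (o ((extChartAt I x₀).symm y)) =
      o' (f ((extChartAt I x₀).symm y))) :
    chartSign o x₀ y =
      Real.sign ((modelBasis E' n).det fun i ↦
          fderivWithin ℝ (extChartAt I' x₁ ∘ f ∘ (extChartAt I x₀).symm) (range I) y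
            (modelBasis E n i)) *
        chartSign o' x₁ (extChartAt I' x₁ (f ((extChartAt I x₀).symm y))) := by
  have hfx : (extChartAt I' x₁).symm (extChartAt I' x₁ (f ((extChartAt I x₀).symm y))) =
      f ((extChartAt I x₀).symm y) := (extChartAt I' x₁).left_inv h₁
  have key := mfderivWithin_extChartAt_symm_comp_fderivWithin_transition hy hf h₁
  have hpt : orientationForm o'
      ((extChartAt I' x₁).symm (extChartAt I' x₁ (f ((extChartAt I x₀).symm y)))) =
      orientationForm o' (f ((extChartAt I x₀).symm y)) := by
    rw [hfx]
  rw [chartSign_eq_sign_orientationForm, chartSign_eq_sign_orientationForm, hpt]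
  have step1 : Real.sign (orientationForm o ((extChartAt I x₀).symm y) fun j ↦
      mfderivWithin 𝓘(ℝ, E) I (extChartAt I x₀).symm (range I) y (modelBasis E n j)) =
      Real.sign (orientationForm o' (f ((extChartAt I x₀).symm y)) fun j ↦
        L (mfderivWithin 𝓘(ℝ, E) I (extChartAt I x₀).symm (range I) y (modelBasis E n j))) := by
    simp only [orientationForm]
    rw [← hoL]
    exact (sign_someVector_orientationMap L _ _).symm
  have step2 : (fun j ↦ L (mfderivWithin 𝓘(ℝ, E) I (extChartAt I x₀).symm (range I) y
      (modelBasis E n j))) = fun j ↦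
        mfderivWithin 𝓘(ℝ, E') I' (extChartAt I' x₁).symm (range I')
          (extChartAt I' x₁ (f ((extChartAt I x₀).symm y)))
          (fderivWithin ℝ (extChartAt I' x₁ ∘ f ∘ (extChartAt I x₀).symm) (range I) y
            (modelBasis E n j)) := by
    funext j
    rw [hL]
    exact (DFunLike.congr_fun key (modelBasis E n j)).symm
  have step3 : orientationForm o' (f ((extChartAt I x₀).symm y)) (fun j ↦
        mfderivWithin 𝓘(ℝ, E') I' (extChartAt I' x₁).symm (range I')
          (extChartAt I' x₁ (f ((extChartAt I x₀).symm y)))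
          (fderivWithin ℝ (extChartAt I' x₁ ∘ f ∘ (extChartAt I x₀).symm) (range I) y
            (modelBasis E n j))) =
      (modelBasis E' n).det (fun i ↦
          fderivWithin ℝ (extChartAt I' x₁ ∘ f ∘ (extChartAt I x₀).symm) (range I) y
            (modelBasis E n i)) *
        orientationForm o' (f ((extChartAt I x₀).symm y)) (fun j ↦
          mfderivWithin 𝓘(ℝ, E') I' (extChartAt I' x₁).symm (range I')
            (extChartAt I' x₁ (f ((extChartAt I x₀).symm y))) (modelBasis E' n j)) :=
    AlternatingMap.apply_comp_comp_basis_eq_basisDet_mul (modelBasis E n) (modelBasis E' n)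
      (orientationForm o' (f ((extChartAt I x₀).symm y)))
      (mfderivWithin 𝓘(ℝ, E') I' (extChartAt I' x₁).symm (range I')
          (extChartAt I' x₁ (f ((extChartAt I x₀).symm y)))).toLinearMap
      (fderivWithin ℝ (extChartAt I' x₁ ∘ f ∘ (extChartAt I x₀).symm) (range I) y).toLinearMap
  rw [step1, step2, step3, real_sign_mul]

/-- **Continuity of the pulled-back orientation.** If `o'` is a continuous orientation family
on `N`, `f : M → N` is `C^∞`, and at every `x` the differential `Df(x)` underlies a linear
isomorphism transporting `o x` to `o' (f x)` (so `f` is an orientation-compatible local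
diffeomorphism), then `o` is a continuous orientation family on `M`: near the centre of the chart
at `x₀`, the chart sign factors as the (locally constant) sign of the Jacobian determinant of the
transition map through `f` times the chart sign of the chart at `f x₀` near its centre
(`chartSign_eq_sign_det_mul_chartSign_transition`). Lee (2013), Prop. 15.6.
[cite: LeeSmoothManifolds2013, Prop. 15.6] -/
theorem isContinuousOrientation_of_orientationMap (ho' : IsContinuousOrientation o')
    {f : M → N} (hf : ContMDiff I I' ∞ f)
    (hcompat : ∀ x, ∃ L : TangentSpace I x ≃ₗ[ℝ] TangentSpace I' (f x),
      (∀ v, L v = mfderiv I I' f x v) ∧ Orientation.map (Fin n) L (o x) = o' (f x)) :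
    IsContinuousOrientation o := by
  intro x₀
  have hy₀ : extChartAt I x₀ x₀ ∈ (extChartAt I x₀).target := mem_extChartAt_target x₀
  have hy₀I : extChartAt I x₀ x₀ ∈ range I := extChartAt_target_subset_range x₀ hy₀
  have hx₀ : (extChartAt I x₀).symm (extChartAt I x₀ x₀) = x₀ := extChartAt_to_inv x₀
  have h₁ : f ((extChartAt I x₀).symm (extChartAt I x₀ x₀)) ∈ (extChartAt I' (f x₀)).source := by
    rw [hx₀]
    exact mem_extChartAt_source (f x₀)
  have hσ_smooth := contDiffWithinAt_transition (x₁ := f x₀) hf hy₀ h₁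
  -- the Jacobian determinant of the transition map through `f`
  set d : E → ℝ := fun y ↦ (modelBasis E' n).det fun i ↦
    fderivWithin ℝ (extChartAt I' (f x₀) ∘ f ∘ (extChartAt I x₀).symm) (range I) y
      (modelBasis E n i) with hd
  -- (1) the transformation formula near the centre
  have h1 : ∀ᶠ y in 𝓝[range I] (extChartAt I x₀ x₀), chartSign o x₀ y = Real.sign (d y) *
      chartSign o' (f x₀) (extChartAt I' (f x₀) (f ((extChartAt I x₀).symm y))) := by
    filter_upwards [eventually_mem_transitionDomain hf.continuous hy₀ h₁] with y hy
    obtain ⟨L, hL, hoL⟩ := hcompat ((extChartAt I x₀).symm y)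
    exact chartSign_eq_sign_det_mul_chartSign_transition o o' hy.1
      ((hf _).mdifferentiableAt (by simp)) hy.2 L hL hoL
  -- (2) the chart sign of `N` is locally constant near the centre of the chart at `f x₀`
  have htend : Tendsto (extChartAt I' (f x₀) ∘ f ∘ (extChartAt I x₀).symm)
      (𝓝[range I] (extChartAt I x₀ x₀)) (𝓝[range I'] (extChartAt I' (f x₀) (f x₀))) := by
    have h := hσ_smooth.continuousWithinAt.tendsto_nhdsWithin
      (mapsTo_transition_range f x₀ (f x₀))
    have hpt : (extChartAt I' (f x₀) ∘ f ∘ (extChartAt I x₀).symm) (extChartAt I x₀ x₀) =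
        extChartAt I' (f x₀) (f x₀) := by
      simp only [Function.comp_apply, hx₀]
    rwa [hpt] at h
  have h2 : ∀ᶠ y in 𝓝[range I] (extChartAt I x₀ x₀),
      chartSign o' (f x₀) (extChartAt I' (f x₀) (f ((extChartAt I x₀).symm y))) =
          chartSign o' (f x₀) (extChartAt I' (f x₀) (f x₀)) ∧
        chartSign o' (f x₀) (extChartAt I' (f x₀) (f ((extChartAt I x₀).symm y))) ≠ 0 :=
    htend.eventually (ho' (f x₀))
  -- (3) the sign of the Jacobian determinant is locally constant
  have hd_cont : ContinuousWithinAt d (range I) (extChartAt I x₀ x₀) :=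
    (continuous_basisDet_apply_comp (modelBasis E n) (modelBasis E' n)).continuousAt
      |>.comp_continuousWithinAt
        (hσ_smooth.fderivWithin_right (m := 0) I.uniqueDiffOn (by simp) hy₀I).continuousWithinAt
  have hd0 : d (extChartAt I x₀ x₀) ≠ 0 := by
    obtain ⟨L, hL, -⟩ := hcompat ((extChartAt I x₀).symm (extChartAt I x₀ x₀))
    refine basisDet_apply_comp_ne_zero (modelBasis E n) (modelBasis E' n) ?_
    rw [fderivWithin_extChartAt_comp_comp_symm hy₀ ((hf _).mdifferentiableAt (by simp)) h₁]
    have hDf : Function.Injective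
        (mfderiv I I' f ((extChartAt I x₀).symm (extChartAt I x₀ x₀))) := by
      intro v w hvw
      apply L.injective
      rw [hL, hL]
      exact hvw
    have hsrc : f ((extChartAt I x₀).symm (extChartAt I x₀ x₀)) ∈
        (extChartAt I' (f x₀)).source := h₁
    exact (isInvertible_mfderiv_extChartAt hsrc).injective.comp
      (hDf.comp (isInvertible_mfderivWithin_extChartAt_symm hy₀).injective)
  have h3 := eventually_sign_eq_of_continuousWithinAt hd_cont hd0
  have hc0 : chartSign o x₀ (extChartAt I x₀ x₀) = Real.sign (d (extChartAt I x₀ x₀)) *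
      chartSign o' (f x₀) (extChartAt I' (f x₀) (f x₀)) := by
    have := h1.self_of_nhdsWithin hy₀I
    rwa [hx₀] at this
  filter_upwards [h1, h2, h3] with y hy1 hy2 hy3
  refine ⟨by rw [hy1, hy3, hy2.1, hc0], ?_⟩
  rw [hy1, hy3]
  exact mul_ne_zero (fun h ↦ hd0 (Real.sign_eq_zero_iff.1 h)) hy2.2

variable [MeasurableSpace E] [BorelSpace E]

variable [MeasurableSpace E'] [BorelSpace E']

/-- **Change of variables for one pair of charts** (Warner (1983), 4.8 eq. (4)): let `f : M → N`
be differentiable, injective and orientation-compatible (`Df(x)` underlies an isomorphism `L`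
with `L_* (o x) = o' (f x)` for every `x`), and let the weight `g : N → ℝ` vanish off
`f '' (chart source at x₀) ∩ (chart source at x₁)`. Then the chart integral, in the chart of `M`
at `x₀`, of `chartSign · (g ∘ f ∘ chart⁻¹) · (f^*β)^(e₁, …, eₙ)` equals the chart integral, in
the chart of `N` at `x₁`, of `chartSign · (g ∘ chart'⁻¹) · β̂(e'₁, …, e'ₙ)`: both integrands
vanish off `U`, resp. off `σ '' U`, and on `U` they correspond under the change of variables
along the transition map `σ` through `f` (`integral_image_eq_integral_abs_basisDet_smul`,
`chartSign_eq_sign_det_mul_chartSign_transition`, `MForm.inChart_pullback_apply`; the sign of the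
Jacobian determinant times the determinant is its absolute value). No continuity of the
integrands is needed. [cite: Warner1983, 4.8(4)] -/
theorem setIntegral_chartIntegrand_pullback_eq {f : M → N} (hf : MDifferentiable I I' f)
    (hfi : Function.Injective f)
    (hcompat : ∀ x, ∃ L : TangentSpace I x ≃ₗ[ℝ] TangentSpace I' (f x),
      (∀ v, L v = mfderiv I I' f x v) ∧ Orientation.map (Fin n) L (o x) = o' (f x))
    (x₀ : M) (x₁ : N) {g : N → ℝ}
    (hg : ∀ z, g z ≠ 0 → z ∈ (extChartAt I' x₁).source ∧ ∃ x ∈ (extChartAt I x₀).source, f x = z)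
    (β : Literature.Geometry.Kaehler.MForm I' N ℝ n) :
    ∫ y in (extChartAt I x₀).target, chartSign o x₀ y * g (f ((extChartAt I x₀).symm y)) *
        (β.pullback I f).inChart x₀ y (modelBasis E n) ∂(modelBasis E n).addHaar =
    ∫ y in (extChartAt I' x₁).target, chartSign o' x₁ y * g ((extChartAt I' x₁).symm y) *
        β.inChart x₁ y (modelBasis E' n) ∂(modelBasis E' n).addHaar := by
  set U : Set E := (extChartAt I x₀).target ∩
    (extChartAt I x₀).symm ⁻¹' (f ⁻¹' (extChartAt I' x₁).source) with hU
  have hUt : U ⊆ (extChartAt I x₀).target := inter_subset_left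
  have hU_meas : MeasurableSet U := by
    have hc : ContinuousOn (f ∘ (extChartAt I x₀).symm) (extChartAt I x₀).target :=
      hf.continuous.comp_continuousOn (continuousOn_extChartAt_symm x₀)
    obtain ⟨u, hu_open, hu⟩ :=
      continuousOn_iff'.1 hc (extChartAt I' x₁).source (isOpen_extChartAt_source x₁)
    have : U = u ∩ (extChartAt I x₀).target := by
      rw [← hu, hU, inter_comm]
      rfl
    rw [this]
    exact hu_open.measurableSet.inter (measurableSet_extChartAt_target x₀)
  -- Step 1: the integrand of `M` vanishes off `U`
  have hzero : ∀ y ∈ (extChartAt I x₀).target \ U,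
      chartSign o x₀ y * g (f ((extChartAt I x₀).symm y)) *
        (β.pullback I f).inChart x₀ y (modelBasis E n) = 0 := by
    intro y hy
    have hg0 : g (f ((extChartAt I x₀).symm y)) = 0 := by
      by_contra h
      exact hy.2 ⟨hy.1, (hg _ h).1⟩
    rw [hg0, mul_zero, zero_mul]
  rw [setIntegral_eq_of_subset_of_forall_sdiff_eq_zero (measurableSet_extChartAt_target x₀)
    hUt hzero]
  -- Step 2: the integrand of `N` vanishes off `σ '' U`
  have himg : (extChartAt I' x₁ ∘ f ∘ (extChartAt I x₀).symm) '' U ⊆ (extChartAt I' x₁).target := by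
    rintro _ ⟨y, hy, rfl⟩
    exact (extChartAt I' x₁).map_source hy.2
  have hzero' : ∀ y' ∈ (extChartAt I' x₁).target \
      (extChartAt I' x₁ ∘ f ∘ (extChartAt I x₀).symm) '' U,
      chartSign o' x₁ y' * g ((extChartAt I' x₁).symm y') *
        β.inChart x₁ y' (modelBasis E' n) = 0 := by
    intro y' hy'
    have hg0 : g ((extChartAt I' x₁).symm y') = 0 := by
      by_contra h
      obtain ⟨-, x, hx, hfx⟩ := hg _ h
      apply hy'.2
      refine ⟨extChartAt I x₀ x, ⟨(extChartAt I x₀).map_source hx, ?_⟩, ?_⟩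
      · show (extChartAt I x₀).symm (extChartAt I x₀ x) ∈ f ⁻¹' (extChartAt I' x₁).source
        rw [mem_preimage, (extChartAt I x₀).left_inv hx, hfx]
        exact (extChartAt I' x₁).map_target hy'.1
      · simp only [Function.comp_apply, (extChartAt I x₀).left_inv hx, hfx]
        exact (extChartAt I' x₁).right_inv hy'.1
    rw [hg0, mul_zero, zero_mul]
  rw [setIntegral_eq_of_subset_of_forall_sdiff_eq_zero (measurableSet_extChartAt_target x₁)
    himg hzero']
  -- Step 3: change of variables along `σ` on `U`
  have hderiv : ∀ y ∈ U, HasFDerivWithinAt (extChartAt I' x₁ ∘ f ∘ (extChartAt I x₀).symm)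
      (fderivWithin ℝ (extChartAt I' x₁ ∘ f ∘ (extChartAt I x₀).symm) (range I) y) U y := by
    intro y hy
    have h0 := mdifferentiableWithinAt_extChartAt_symm (I := I) hy.1
    have h2 : MDifferentiableAt I' 𝓘(ℝ, E') (extChartAt I' x₁) (f ((extChartAt I x₀).symm y)) :=
      mdifferentiableAt_extChartAt (by rw [← extChartAt_source I']; exact hy.2)
    have hd : MDifferentiableWithinAt 𝓘(ℝ, E) 𝓘(ℝ, E')
        (extChartAt I' x₁ ∘ f ∘ (extChartAt I x₀).symm) (range I) y :=
      (h2.comp _ (hf _)).comp_mdifferentiableWithinAt _ h0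
    exact (mdifferentiableWithinAt_iff_differentiableWithinAt.1 hd).hasFDerivWithinAt.mono
      (hUt.trans (extChartAt_target_subset_range x₀))
  have hinj : InjOn (extChartAt I' x₁ ∘ f ∘ (extChartAt I x₀).symm) U := by
    intro y hy y' hy' h
    simp only [Function.comp_apply] at h
    have h2 : f ((extChartAt I x₀).symm y) = f ((extChartAt I x₀).symm y') :=
      (extChartAt I' x₁).injOn hy.2 hy'.2 h
    rw [← (extChartAt I x₀).right_inv hy.1, ← (extChartAt I x₀).right_inv hy'.1, hfi h2]
  rw [integral_image_eq_integral_abs_basisDet_smul (modelBasis E n) (modelBasis E' n) hU_meas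
    hderiv hinj]
  -- Step 4: the integrands agree pointwise on `U`
  refine setIntegral_congr_fun hU_meas fun y hy ↦ ?_
  obtain ⟨L, hL, hoL⟩ := hcompat ((extChartAt I x₀).symm y)
  have hfx : (extChartAt I' x₁).symm (extChartAt I' x₁ (f ((extChartAt I x₀).symm y))) =
      f ((extChartAt I x₀).symm y) := (extChartAt I' x₁).left_inv hy.2
  simp only [Function.comp_apply, smul_eq_mul]
  rw [chartSign_eq_sign_det_mul_chartSign_transition o o' hy.1 (hf _) hy.2 L hL hoL,
    β.inChart_pullback_apply hy.1 (hf _) hy.2, hfx,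
    ContinuousAlternatingMap.apply_comp_basis_eq_basisDet_mul (modelBasis E n) (modelBasis E' n),
    ← real_sign_mul_self]
  ring

end Sign

end Literature.NumberTheory.Transcendental
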